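import Summits.BirchSwinnertonDyer.BirchSwinnertonDyer.Theorems.AlignedTransportAtTwoMainConjectureOfRankZeroBSDAtTwoHalfDescentBaseIndexSelmer
import Summits.BirchSwinnertonDyer.BirchSwinnertonDyer.Theorems.AlignedTransportAtTwoMainConjectureOfRankZeroBSDAtTwoHalfDescentLayerIndexGrowthFiniteSeed
import Summits.BirchSwinnertonDyer.BirchSwinnertonDyer.Theorems.AlignedTransportAtTwoMainConjectureOfRankZeroBSDAtTwoHalfDescentLayerIndexGrowthFiniteCompleteTwo
import HarnessLib

/-!
# Route `AlignedTransportAtTwo`, crux C2 `MainConjectureOfRankZeroBSDAtTwo` (stmt-BirchSwinnertonDyer-22298):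
# THE BASE TERM CARRIES `p^μ`, V — `p = 2`, THE SEED CELL: `2^{2ⁿ·μ₂} ∣ #Sel_{2^∞}(W/ℚ_n)·#ker g_n(W/ℚ_n)` for EVERY elliptic `W/ℚ`, with both factors finite positive on the
# ordinary cell (`μ₂ ≤ log₂(#Sel_{2^∞}(W/ℚ)·#ker g_0(W))` — gen 59's `#ker g_1` factor is gone); an ODD product at the base kills `μ` AND `λ`; and PRINT + `BSD(W,2)` +
# ONE layer with `0 < #Sel_{2^∞}(W/ℚ_n)·#ker g_n < 2^{2ⁿ}` per cyclotomic datum ⟹ Mazur's `2`-adic main conjecture for `W`; C2 BY NAME from PRINT + that certificate (CONDITIONAL)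

HONEST FRAMING (cell `bsd-f1-sign2`, WIDTH-5 attached prover seat `bsd-line-att-p5` gen 60 on line `birth` of the lead `bsd-line-att-p2`;
`--supports` stmt-BirchSwinnertonDyer-22298, closes nothing; BSD is NOT proved by any of this; the crux C2, its verdict «blocked-on
`Rank1Residual.GreenbergMuConjectureIrreducible`» and every registered stub (P / T / Kμ / LimDoor / MuIneqʳ / PFμ⁺) are untouched). THEOREMS ONLY — no `def`,
no instance, no named fact, no `sorry`. §3 sits in the theses cone by design (it names the crux, like the lead's `…Seed` and gens 56/57's `…GrowthSeed` / `…GrowthFiniteSeed`);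
§1–§2 are route-independent. Sequel of this gen's `…BaseIndexSelmer` (`p^{pⁿ·μ} ∣ #Sel_{p^∞}(E/K_n)·#ker g_n` for every `K`, `p`, `κ`, `n`; base door) with gen 57's
`…GrowthFiniteCompleteTwo.exists_forall_natCard_kerG_pos_le_two` (`∃ C, ∀ n, 0 < #ker g_n ≤ C` on the good-ordinary-at-`2` cell — Greenberg's Lemma 3.5 at `2`, tree) and the lead's
seed `AlignedTransportAtTwoSeed.mazurMainConjecture_two_of_bsdp_of_mu_eq_zero` (PRINT + `BSD(W,2)` + «`μ = 0` for every cyclotomic datum» ⟹ `MazurMainConjecture W 2`).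

THE POINT (`W/ℚ` elliptic; `κ` a `ℤ₂`-extension of `ℚ` with topological generator `γ`; `D` any Pontryagin-dual datum with `X` torsion).
* §1 ★★★ `two_pow_mul_mu_dvd`: **`2^{2ⁿ·μ₂(X(W/ℚ_∞))} ∣ #Sel_{2^∞}(W/ℚ_n) · #ker g_n(W/ℚ_n)` for EVERY `W/ℚ`, EVERY `n`** — no reduction, torsion or rank hypothesis; ★★ `charIdeal_eq_top_of_odd`:
  **`#Sel_{2^∞}(W/ℚ)·#ker g_0(W)` ODD ⟹ `char X(W/ℚ_∞) = Λ`, `μ₂ = 0`, `λ₂ = 0`** (gen 59's odd door `mu_eq_zero_of_odd` had THREE factors and concluded `μ₂ = 0` only).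
* §2 (good ORDINARY `2`, globally minimal, `κ` cyclotomic — the seed cell; both kernel factors finite positive by the tree) ★★★ `pow_mul_mu_le_log_seed`:
  **`2ⁿ·μ₂ ≤ log₂(#Sel_{2^∞}(W/ℚ_n)·#ker g_n)` whenever `Sel_{2^∞}(W/ℚ_n)` is finite** (rank `0` at `ℚ_n`); at the base ★★★ `mu_le_log_seed`: **`μ₂ ≤ log₂(#Sel_{2^∞}(W/ℚ)·#ker g_0(W))`** —
  the answer to REF2's P-att5-59 vacuity caveat WITHOUT `#ker g_1` and without the `E[2]`-irreducibility binder.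
* §3 (theses cone) ★★★ `mazurMainConjecture_two_of_bsdp_of_natCard_selmerLayer_mul_kerG_lt`: PRINT (Kato 17.4 (1)(2) at `2`, Greenberg 4.1, period unit, modularity, GZK) + good ordinary at
  `2` + no rational `2`-torsion + `r_an = 0` + `BSD(W,2)` + CERTIFICATE «for every cyclotomic `(κ, γ)` SOME layer `n` with **`0 < #Sel_{2^∞}(W/ℚ_n)·#ker g_n(W/ℚ_n) < 2^{2ⁿ}`**» ⟹
  **`MazurMainConjecture W 2`**; ★★★ `mainConjectureOfRankZeroBSDAtTwo_of_natCard_selmerLayer_mul_kerG_lt`: **C2 BY NAME** from PRINT + that certificate for every seed curve (CONDITIONAL: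
  displayed hypothesis, nothing credited, the item stays open). Compared with gens 55–59 the certificate involves NO limit object, NO growth/norm operator, NO `γ`-action, NO twist and
  NO second layer: the order of the honest `2^∞`-Selmer group of `W` over ONE layer `ℚ_n = ℚ(ζ_{2^{n+2}})⁺` (at rank `0` there: `#Ш(W/ℚ_n)[2^∞]`) times Greenberg's control kernel AT
  THAT layer, against `2^{2ⁿ}` (`n = 2`: `< 16`; `n = 3`: `< 256`); and it is COMPLETE over `ℚ` in the rank-`0` tower (file IV).
What is NOT claimed: nothing about any curve; no Selmer group or kernel computed; BSD is not proved; C2 untouched. Memo `Cruxes/MainConjectureOfRankZeroBSDAtTwo/BASE-TERM-att-p5-g60.md`.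

References: R. Greenberg, LNM 1716 (1999), Conj. 1.11, §3 Lemmas 3.1–3.5 (pp. 85–90), §4 Thm. 4.1, Lemmas 4.2–4.3 (p. 103) [GreenbergLNM1716]; K. Kato, Astérisque 295 (2004)
Thm. 17.4 (1)(2) (p. 273) [Kato2004Asterisque]; B. Mazur, Invent. Math. 18 (1972) §6 [Mazur1972]; R. L. Miller, LMS J. Comput. Math. 14 (2011) Def. 1.1 [Miller2011LMS].
-/

set_option linter.dupNamespace false
set_option autoImplicit false

noncomputable section

open scoped Classical AddSubgroup MatrixGroups ModularForm Polynomial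

namespace Summit.BirchSwinnertonDyer.BirchSwinnertonDyer.Theorems.AlignedTransportAtTwoHalfDescentBaseIndexSeed

open CongruenceSubgroup WeierstrassCurve Literature.NumberTheory.EllipticCurves Literature.NumberTheory.EllipticCurves.IwasawaDual
  Literature.NumberTheory.EllipticCurves.IwasawaAlgebra
  Literature.NumberTheory.EllipticCurves.ModularForms
  Literature.NumberTheory.EllipticCurves.Rank1Residual
  Literature.NumberTheory.EllipticCurves.Rank1Residual.Typed
  Literature.NumberTheory.EllipticCurves.Greenberg1999
  Summit.BirchSwinnertonDyer.Rank1Residual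
  Summit.BirchSwinnertonDyer.Rank1Residual.X1.MuLambda
  Summit.BirchSwinnertonDyer.Rank1Residual.F1Sign2
  Summit.BirchSwinnertonDyer.Rank1Residual.Iwasawa
  Summit.BirchSwinnertonDyer.BirchSwinnertonDyer.Theorems.Rank1ResidualX1Defs
  Summit.BirchSwinnertonDyer.BirchSwinnertonDyer.Theses.AlignedTransportAtTwo
  Summit.BirchSwinnertonDyer.BirchSwinnertonDyer.Theorems.AlignedTransportAtTwoSeed
  Summit.BirchSwinnertonDyer.BirchSwinnertonDyer.Theorems.AlignedTransportAtTwoHalfDescentLayerIndexGrowthFiniteCompleteTwo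
  Summit.BirchSwinnertonDyer.BirchSwinnertonDyer.Theorems.AlignedTransportAtTwoHalfDescentBaseIndexSelmer

/-! ## §1 Every `W/ℚ`: `2^{2ⁿ·μ₂} ∣ #Sel_{2^∞}(W/ℚ_n)·#ker g_n`; an odd base product kills `μ` and `λ` -/

section AnyCurve

variable (W : WeierstrassCurve ℚ) [W.IsElliptic] (κ : ZpExtension ℚ 2) {γ : Field.absoluteGaloisGroup ℚ}

/-- ★★★ `p = 2`: **`2^{2ⁿ·μ₂(X(W/ℚ_∞))} ∣ #Sel_{2^∞}(W/ℚ_n) · #ker g_n(W/ℚ_n)`** for EVERY elliptic `W/ℚ`, every `ℤ₂`-extension `κ` of `ℚ` with topological generator `γ`, every Pontryagin-dual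
datum with `X` torsion and EVERY layer `n` (`ℚ_n = ℚ(ζ_{2^{n+2}})⁺` for the cyclotomic `κ`) — no reduction, torsion or rank hypothesis (`Nat.card`). At `n = 0`: `2^{μ₂} ∣ #Sel_{2^∞}(W/ℚ)·#ker g_0(W)`.
[cite: GreenbergLNM1716, Conj. 1.11, §4 Lemmas 4.2–4.3] [cite: Mazur1972, §6] -/
theorem two_pow_mul_mu_dvd (hγ : κ.IsTopGenerator γ) (D : W.SelmerDualData κ γ) (hD : D.IsTorsion) (n : ℕ) :
    2 ^ (2 ^ n * D.mu) ∣ Nat.card ↥(W.selmerLayer κ n) * Nat.card (W.KerG κ n) := by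
  haveI : Module.Finite (IwasawaAlgebra 2) D.X := D.module_finite_holds hγ
  exact pow_mul_mu_dvd_natCard_selmerLayer_mul_kerG W κ hγ D hD n

/-- ★★ `p = 2`, THE ODD BASE DOOR: **`#Sel_{2^∞}(W/ℚ) · #ker g_0(W)` odd ⟹ `char_Λ X(W/ℚ_∞) = Λ`, `μ₂ = 0` and `λ₂ = 0`** for every elliptic `W/ℚ`, every `ℤ₂`-extension datum with `X`
torsion (gen 59's `mu_eq_zero_of_odd` needed the third factor `#ker g_1(W)` and `E[2]` irreducible, and gave `μ₂ = 0` only). On the seed cell `2` is anomalous and `Ш[2]`, `ker g_0` are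
`2`-groups, so in practice the door asks `Sel_{2^∞}(W/ℚ) = 0` and `ker g_0(W) = 0`. [cite: GreenbergLNM1716, §4 Thm. 4.1, Lemma 4.3 and p. 104] -/
theorem charIdeal_eq_top_of_odd (hγ : κ.IsTopGenerator γ) (D : W.SelmerDualData κ γ) (hD : D.IsTorsion)
    (hodd : Odd (Nat.card ↥(W.selmerLayer κ 0) * Nat.card (W.KerG κ 0))) : D.charIdeal = ⊤ ∧ D.mu = 0 ∧ D.lambda = 0 := by
  haveI : Module.Finite (IwasawaAlgebra 2) D.X := D.module_finite_holds hγ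
  exact charIdeal_eq_top_of_not_dvd W κ hγ D hD (fun h ↦ (Nat.not_even_iff_odd.mpr hodd) (even_iff_two_dvd.mpr h))

end AnyCurve

/-! ## §2 The seed cell (good ordinary `2`, globally minimal, `κ` cyclotomic): both kernel factors finite positive, `μ₂ ≤ log₂(#Sel_{2^∞}(W/ℚ_n)·#ker g_n)/2ⁿ` -/

section Seed

variable (W : WeierstrassCurve ℚ) [W.IsElliptic] [W.IsGloballyMinimal] (κ : ZpExtension ℚ 2) {γ : Field.absoluteGaloisGroup ℚ}

/-- ★★★ **THE `μ`-BOUND ON THE SEED CELL AT LAYER `n`: `0 < #Sel_{2^∞}(W/ℚ_n)·#ker g_n` and `2ⁿ·μ₂(X(W/ℚ_∞)) ≤ log₂(#Sel_{2^∞}(W/ℚ_n)·#ker g_n(W/ℚ_n))`** for `W/ℚ` elliptic,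
globally minimal, good ordinary at `2`, `κ` cyclotomic with topological generator `γ`, every torsion dual datum, and every layer `n` at which `Sel_{2^∞}(W/ℚ_n)` is FINITE (rank `0`
at `ℚ_n`, `Ш[2^∞]` finite there). Greenberg's control kernel is finite positive by the tree (L.3.5 at `2`); each layer climbed halves the bound per unit of `log₂`.
[cite: GreenbergLNM1716, Conj. 1.11, §3 Lemmas 3.3–3.5, §4 Thm. 4.1, Lemma 4.3] -/
theorem pow_mul_mu_le_log_seed (hord : IsOrdinaryAt W 2) (hκ : κ.IsCyclotomic) (hγ : κ.IsTopGenerator γ) (D : W.SelmerDualData κ γ) (hD : D.IsTorsion) (n : ℕ)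
    [Finite ↥(W.selmerLayer κ n)] :
    0 < Nat.card ↥(W.selmerLayer κ n) * Nat.card (W.KerG κ n) ∧ 2 ^ n * D.mu ≤ Nat.log 2 (Nat.card ↥(W.selmerLayer κ n) * Nat.card (W.KerG κ n)) := by
  haveI : Module.Finite (IwasawaAlgebra 2) D.X := D.module_finite_holds hγ
  obtain ⟨C, hC⟩ := exists_forall_natCard_kerG_pos_le_two W κ hord hκ
  have hpos : 0 < Nat.card ↥(W.selmerLayer κ n) * Nat.card (W.KerG κ n) := Nat.mul_pos Nat.card_pos (hC n).1
  exact ⟨hpos, pow_mul_mu_le_log W κ hγ D hD hpos⟩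

/-- ★★★ **`μ₂(X(W/ℚ_∞)) ≤ log₂(#Sel_{2^∞}(W/ℚ) · #ker g_0(W))`** on the seed cell with `Sel_{2^∞}(W/ℚ)` finite (rank `0`, `Ш(W)[2^∞]` finite): the `μ`-invariant is bounded by TWO
finite base-level numbers of `W` — its `2^∞`-Selmer order over `ℚ` and Greenberg's base control kernel (gen 59 `…GrowthFiniteTwistOrbitSeed.mu_le_log` carried `#ker g_1(W)` as a
third factor and the binder «no rational `2`-torsion»). [cite: GreenbergLNM1716, Conj. 1.11, §3 Lemma 3.5, §4 Thm. 4.1, Lemma 4.3] -/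
theorem mu_le_log_seed (hord : IsOrdinaryAt W 2) (hκ : κ.IsCyclotomic) (hγ : κ.IsTopGenerator γ) (D : W.SelmerDualData κ γ) (hD : D.IsTorsion)
    [Finite ↥(W.selmerLayer κ 0)] :
    0 < Nat.card ↥(W.selmerLayer κ 0) * Nat.card (W.KerG κ 0) ∧ D.mu ≤ Nat.log 2 (Nat.card ↥(W.selmerLayer κ 0) * Nat.card (W.KerG κ 0)) := by
  obtain ⟨hpos, hle⟩ := pow_mul_mu_le_log_seed W κ hord hκ hγ D hD 0
  rw [pow_zero, one_mul] at hle
  exact ⟨hpos, hle⟩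

/-- ★★ On the seed cell the `γ`-free door reads on FINITE numbers at every layer: `Sel_{2^∞}(W/ℚ_n)` finite and **`#Sel_{2^∞}(W/ℚ_n) · #ker g_n(W/ℚ_n) < 2^{2ⁿ}` ⟹ `μ₂(X(W/ℚ_∞)) = 0`**
(positivity is automatic). [cite: GreenbergLNM1716, Conj. 1.11, §3 Lemma 3.5, §4 Lemma 4.3] -/
theorem mu_eq_zero_of_natCard_selmerLayer_mul_kerG_lt_seed (hord : IsOrdinaryAt W 2) (hκ : κ.IsCyclotomic) (hγ : κ.IsTopGenerator γ) (D : W.SelmerDualData κ γ)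
    (hD : D.IsTorsion) {n : ℕ} [Finite ↥(W.selmerLayer κ n)] (hlt : Nat.card ↥(W.selmerLayer κ n) * Nat.card (W.KerG κ n) < 2 ^ (2 ^ n)) : D.mu = 0 := by
  haveI : Module.Finite (IwasawaAlgebra 2) D.X := D.module_finite_holds hγ
  exact mu_eq_zero_of_natCard_selmerLayer_mul_kerG_pos_lt W κ hγ D hD (pow_mul_mu_le_log_seed W κ hord hκ hγ D hD n).1 hlt

end Seed

/-! ## §3 The seed of line `birth` fed by the `γ`-free certificate (theses cone) -/

section Crux

variable (W : WeierstrassCurve ℚ) [W.IsElliptic] [W.IsGloballyMinimal]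

/-- ★★★ **MAZUR'S `2`-ADIC MAIN CONJECTURE FROM `BSD(W,2)` AND ONE SMALL HONEST LAYER PER CYCLOTOMIC DATUM.** `W/ℚ` elliptic, globally minimal, good ordinary at `2`, no rational
point of order `2`, `r_an = 0`, `BSD(W,2)`; PRINT: Kato 17.4 (1)(2) at `2` (`h17`), Greenberg 4.1 (`hGr`), the period unit (`hper`), modularity (`hmod`), GZK (`hGZK`). CERTIFICATE (displayed,
per curve, ONE honest finite-level Selmer ORDER): for every cyclotomic `(κ, γ)` there is a layer `n` with **`0 < #Sel_{2^∞}(W/ℚ_n) · #ker g_n(W/ℚ_n) < 2^{2ⁿ}`** (`ℚ_n = ℚ(ζ_{2^{n+2}})⁺`,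
`ker g_n = A_n/Sel_n` Greenberg's control kernel). Then **`MazurMainConjecture W 2`**. [cite: Kato2004Asterisque, Thm. 17.4 (1)(2) (p. 273)] [cite: GreenbergLNM1716, Thm. 4.1 (p. 102), Conj. 1.11, §4 Lemma 4.3]
[cite: Miller2011LMS, Def. 1.1] -/
theorem mazurMainConjecture_two_of_bsdp_of_natCard_selmerLayer_mul_kerG_lt
    (h17 : ∀ [NeZero (W.conductorNorm ℤ)] (f : CuspForm (Gamma0 (W.conductorNorm ℤ)) 2), kato_divisibility_allPrimes W 2 (f := f))
    (hGr : Greenberg1999.thm41_charValue_rankZero_anyPrime)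
    (hper : realPeriodRat_eq_unit_mul_plusPeriod_two) (hmod : nonempty_modularParametrizationData)
    (hGZK : rank_eq_analyticRank_of_analyticRank_le_one) (hord : IsOrdinaryAt W 2)
    (ht : ∀ x : ℚ, ¬ HasRationalTwoTorsionX W x) (hr : W.analyticRank = 0) (hbsd : BSDp W 2)
    (hcert : ∀ (κ : ZpExtension ℚ 2) (γ : Field.absoluteGaloisGroup ℚ), κ.IsCyclotomic → κ.IsTopGenerator γ → IsCyclotomicVariable 2 γ →
      ∃ n : ℕ, 0 < Nat.card ↥(W.selmerLayer κ n) * Nat.card (W.KerG κ n) ∧ Nat.card ↥(W.selmerLayer κ n) * Nat.card (W.KerG κ n) < 2 ^ (2 ^ n)) :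
    MazurMainConjecture W 2 := by
  refine AlignedTransportAtTwoSeed.mazurMainConjecture_two_of_bsdp_of_mu_eq_zero W h17 hGr hper hmod hGZK hord ht hr hbsd ?_
  intro κ γ hκ hγ hγ' D hD
  haveI : Module.Finite (IwasawaAlgebra 2) D.X := D.module_finite_holds hγ
  obtain ⟨n, hpos, hlt⟩ := hcert κ γ hκ hγ hγ'
  exact mu_eq_zero_of_natCard_selmerLayer_mul_kerG_pos_lt W κ hγ D hD hpos hlt

/-- ★★★ **C2 FROM PRINT + ONE SMALL HONEST LAYER PER SEED CURVE.** PRINT (`h17` for every curve, `hGr`, `hper`, `hmod`, `hGZK`) and, for every seed-cell curve `W` (elliptic, globally minimal,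
non-CM, good ordinary at `2`, no rational `2`-torsion, `Δ ∉ ℚ²`, `r_an = 0`) and every cyclotomic `(κ, γ)`, SOME layer `n` with **`0 < #Sel_{2^∞}(W/ℚ_n) · #ker g_n(W/ℚ_n) < 2^{2ⁿ}`** ⟹ the crux
statement **`MainConjectureOfRankZeroBSDAtTwo`** by name. CONDITIONAL result (the certificate is a displayed hypothesis; nothing is credited; the item stays open); the analytic `μ₂ = 0`
hypothesis and `BSD(W,2)` of C2 are consumed by the seed. [cite: Kato2004Asterisque, Thm. 17.4 (1)(2) (p. 273)] [cite: GreenbergLNM1716, Thm. 4.1 (p. 102), §1 Conj. 1.11 (p. 58)] -/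
theorem mainConjectureOfRankZeroBSDAtTwo_of_natCard_selmerLayer_mul_kerG_lt
    (h17 : ∀ (V : WeierstrassCurve ℚ) [V.IsElliptic] [V.IsGloballyMinimal] [NeZero (V.conductorNorm ℤ)]
      (f : CuspForm (Gamma0 (V.conductorNorm ℤ)) 2), kato_divisibility_allPrimes V 2 (f := f))
    (hGr : Greenberg1999.thm41_charValue_rankZero_anyPrime)
    (hper : realPeriodRat_eq_unit_mul_plusPeriod_two) (hmod : nonempty_modularParametrizationData)
    (hGZK : rank_eq_analyticRank_of_analyticRank_le_one)
    (hcert : ∀ (W : WeierstrassCurve ℚ) [W.IsElliptic] [W.IsGloballyMinimal], ¬ W.HasCM →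
      IsOrdinaryAt W 2 → (∀ x : ℚ, ¬ HasRationalTwoTorsionX W x) → ¬ IsSquare W.Δ → W.analyticRank = 0 →
      ∀ (κ : ZpExtension ℚ 2) (γ : Field.absoluteGaloisGroup ℚ), κ.IsCyclotomic → κ.IsTopGenerator γ → IsCyclotomicVariable 2 γ →
        ∃ n : ℕ, 0 < Nat.card ↥(W.selmerLayer κ n) * Nat.card (W.KerG κ n) ∧ Nat.card ↥(W.selmerLayer κ n) * Nat.card (W.KerG κ n) < 2 ^ (2 ^ n)) :
    MainConjectureOfRankZeroBSDAtTwo := by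
  intro W _ _ hcm hord ht hsq hr _hμan hbsd
  exact mazurMainConjecture_two_of_bsdp_of_natCard_selmerLayer_mul_kerG_lt W (fun f => h17 W f) hGr hper hmod hGZK hord ht hr hbsd (hcert W hcm hord ht hsq hr)

end Crux

end Summit.BirchSwinnertonDyer.BirchSwinnertonDyer.Theorems.AlignedTransportAtTwoHalfDescentBaseIndexSeed

end
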